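import Mathlib
import HarnessLib
import Summits.NavierStokesRegularity.NavierStokesRegularity.Theorems.PoloidalWindowDoorPoloidalWindowRigidityWindow

/-!
# Door S11 `LocalTubeDoorHelicity` (nsreg-p1 ROUND-11, the FROBENIUS / helicity-density window door), profile crux K2⁗
# `FrobeniusWindowRigidity` — the support statement `HelicityWindowToSlab` (window ⇒ everywhere) and the reduction of
# the window form to the profile form `FrobeniusProfileRigidity`

Cell ns-regularity-ideate, seat p6 (route-directed support for an UNSTAGED door; anchor
`--supports stmt-NavierStokesRegularity-20018`, the profile item of route LocalSineTubeDoor whose analyticity tools are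
re-used; edge re-pointed at birth).  Statements are those of nsreg-p1's `r11/Sketch11.lean` with the profile class
`IsTypeIProfile C v` spelled out as its four clauses and `helicityDensity (v s) y` unfolded to `⟪v s y, curl (v s) y⟫`:

* `analyticOnNhd_helicity_slice` — for a profile of the class every slice helicity density
  `y ↦ ⟪v s y, curl (v s) y⟫`, `s < 0`, is real-analytic on `ℝ³` (slice analyticity
  `…ProfileAlignedWindowRigidityAncient.analyticOnNhd_slice`, `analyticOnNhd_curl`, and the inner product is a continuous
  bilinear map); `continuous_helicity_slice` — hence continuous;
* `real_eq_zero_spread` — identity-theorem spreading for a real-analytic scalar on `ℝ³`;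
* `helicityWindowToSlab` — **= `HelicityWindowToSlab` of the sketch, PROVED**: if at every `s < 0` the helicity
  density vanishes on some nonempty open window, it vanishes identically on every slice;
* `frobeniusWindowRigidity_of_profileRigidity` — **the window crux K2⁗ `FrobeniusWindowRigidity` follows from its profile
  form `FrobeniusProfileRigidity`** (the sketch's `frobeniusWindowRigidity_of` with its first hypothesis discharged), so the
  open content of K2⁗ is exactly the profile-Liouville statement on the Frobenius class `𝔉 = {v · curl v ≡ 0}`.

WHAT THIS IS NOT: not a claim about Navier–Stokes regularity and not K2⁗; support lemmas (analytic continuation from a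
window) for a door route that is not yet staged (bears_on LADDER-NS N0).
-/

noncomputable section

-- the summit and its single sub-problem share the name (CONVENTIONS §1), as in every Theorems file
set_option linter.dupNamespace false

namespace Summit.NavierStokesRegularity.NavierStokesRegularity.Theorems.LocalHelicityTubeDoorFrobeniusWindowRigidityWindow

open MeasureTheory Set Function Filter Topology TopologicalSpace Metric
open scoped RealInnerProductSpace InnerProductSpace
open Literature.Analysis Literature.Analysis.FluidPDE
open Summit.NavierStokesRegularity.NavierStokesRegularity.Theorems.LocalSineTubeDoorProfileAlignedWindowRigidityAncient
open Summit.NavierStokesRegularity.NavierStokesRegularity.Theorems.LocalSineTubeDoorProfileAlignedWindowRigidity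

/-- The inner product of two real-analytic vector fields on `ℝ³` is a real-analytic scalar (the inner product is a
continuous bilinear map). -/
theorem analyticOnNhd_inner {F G : EuclideanSpace ℝ (Fin 3) → EuclideanSpace ℝ (Fin 3)}
    (hF : AnalyticOnNhd ℝ F univ) (hG : AnalyticOnNhd ℝ G univ) :
    AnalyticOnNhd ℝ (fun y => ⟪F y, G y⟫_ℝ) univ := by
  intro y hy
  exact ((innerSL ℝ (E := EuclideanSpace ℝ (Fin 3))).analyticAt_bilinear (F y, G y)).comp₂ (hF y hy) (hG y hy)

/-- **Slice helicity densities of a profile of the class are real-analytic**: for `s < 0` the scalar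
`y ↦ ⟪v s y, curl (v s) y⟫` is real-analytic on `ℝ³`. -/
theorem analyticOnNhd_helicity_slice {C : ℝ} {v : ℝ → EuclideanSpace ℝ (Fin 3) → EuclideanSpace ℝ (Fin 3)}
    (hrate : HasTypeITimeDecay C v) (hcont : ContinuousOn (uncurry v) (Iio (0 : ℝ) ×ˢ univ))
    (hmild : ∀ s t : ℝ, s < t → t < 0 → ∀ x,
      v t x = UnboundedOperators.heatExtension (v s) (t - s) x - oseenDuhamel 1 s v v t x)
    {s : ℝ} (hs : s < 0) :
    AnalyticOnNhd ℝ (fun y => ⟪v s y, curl (v s) y⟫_ℝ) univ :=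
  have hslice := analyticOnNhd_slice hcont (bdd_of_hasTypeITimeDecay hrate) hmild hs
  analyticOnNhd_inner hslice (analyticOnNhd_curl hslice)

/-- Slice helicity densities of a profile of the class are continuous. -/
theorem continuous_helicity_slice {C : ℝ} {v : ℝ → EuclideanSpace ℝ (Fin 3) → EuclideanSpace ℝ (Fin 3)}
    (hrate : HasTypeITimeDecay C v) (hcont : ContinuousOn (uncurry v) (Iio (0 : ℝ) ×ˢ univ))
    (hmild : ∀ s t : ℝ, s < t → t < 0 → ∀ x,
      v t x = UnboundedOperators.heatExtension (v s) (t - s) x - oseenDuhamel 1 s v v t x)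
    {s : ℝ} (hs : s < 0) :
    Continuous (fun y => ⟪v s y, curl (v s) y⟫_ℝ) := by
  rw [← continuousOn_univ]
  exact (analyticOnNhd_helicity_slice hrate hcont hmild hs).continuousOn

/-- Identity-theorem spreading for a real-analytic scalar on `ℝ³`: vanishing on a nonempty open set forces vanishing
everywhere (`ℝ³` is connected). -/
theorem real_eq_zero_spread {g : EuclideanSpace ℝ (Fin 3) → ℝ} (hg : AnalyticOnNhd ℝ g univ)
    {U : Set (EuclideanSpace ℝ (Fin 3))} (hU : IsOpen U) (hne : U.Nonempty) (h : ∀ y ∈ U, g y = 0) :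
    ∀ y, g y = 0 := by
  obtain ⟨y₀, hy₀⟩ := hne
  have hev : g =ᶠ[𝓝 y₀] 0 := Filter.eventually_of_mem (hU.mem_nhds hy₀) fun y hy => h y hy
  intro y
  exact hg.eqOn_zero_of_preconnected_of_eventuallyEq_zero isPreconnected_univ (mem_univ y₀) hev (mem_univ y)

/-- **`HelicityWindowToSlab` (nsreg-p1 ROUND-11, support statement of K2⁗), PROVED**: for a profile of the Type-I
class, if at every `s < 0` the helicity density `⟪v s, curl (v s)⟫` vanishes on some nonempty open window, then it
vanishes identically on every slice `s < 0` (slice analyticity + identity theorem). -/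
theorem helicityWindowToSlab :
    ∀ (C : ℝ) (v : ℝ → EuclideanSpace ℝ (Fin 3) → EuclideanSpace ℝ (Fin 3)),
    Literature.Analysis.FluidPDE.HasTypeITimeDecay C v →
    ContinuousOn (Function.uncurry v) (Set.Iio (0 : ℝ) ×ˢ Set.univ) →
    (∀ s t : ℝ, s < t → t < 0 → ∀ x, v t x =
      Literature.Analysis.UnboundedOperators.heatExtension (v s) (t - s) x -
        Literature.Analysis.FluidPDE.oseenDuhamel 1 s v v t x) →
    (∀ t < 0, Literature.Analysis.FluidPDE.VectorCalculus.IsDivFree (v t)) →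
    (∀ s < 0, ∃ U : Set (EuclideanSpace ℝ (Fin 3)), IsOpen U ∧ U.Nonempty ∧
      ∀ y ∈ U, ⟪v s y, Literature.Analysis.FluidPDE.curl (v s) y⟫_ℝ = 0) →
    ∀ s < 0, ∀ y : EuclideanSpace ℝ (Fin 3), ⟪v s y, Literature.Analysis.FluidPDE.curl (v s) y⟫_ℝ = 0 := by
  intro C v hrate hcont hmild _ hwin s hs
  obtain ⟨U, hU, hne, hal⟩ := hwin s hs
  exact real_eq_zero_spread (analyticOnNhd_helicity_slice hrate hcont hmild hs) hU hne hal

/-- **K2⁗ window form ⇐ K2⁗ profile form** (the sketch's `frobeniusWindowRigidity_of` with `HelicityWindowToSlab`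
discharged): if every profile of the Type-I class with identically vanishing helicity density is not backward-singular at
the apex (`FrobeniusProfileRigidity`, OPEN), then already a profile whose helicity density vanishes on SOME nonempty open
window at every negative time is not backward-singular (`FrobeniusWindowRigidity`, the text of the route crux K2⁗ with
the class spelled out). -/
theorem frobeniusWindowRigidity_of_profileRigidity
    (hprofile : ∀ (C : ℝ) (v : ℝ → EuclideanSpace ℝ (Fin 3) → EuclideanSpace ℝ (Fin 3)),
      Literature.Analysis.FluidPDE.HasTypeITimeDecay C v →
      ContinuousOn (Function.uncurry v) (Set.Iio (0 : ℝ) ×ˢ Set.univ) →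
      (∀ s t : ℝ, s < t → t < 0 → ∀ x, v t x =
        Literature.Analysis.UnboundedOperators.heatExtension (v s) (t - s) x -
          Literature.Analysis.FluidPDE.oseenDuhamel 1 s v v t x) →
      (∀ t < 0, Literature.Analysis.FluidPDE.VectorCalculus.IsDivFree (v t)) →
      (∀ s < 0, ∀ y : EuclideanSpace ℝ (Fin 3), ⟪v s y, Literature.Analysis.FluidPDE.curl (v s) y⟫_ℝ = 0) →
      ¬ Literature.Analysis.FluidPDE.IsBackwardSingularPoint v 0) :
    ∀ (C : ℝ) (v : ℝ → EuclideanSpace ℝ (Fin 3) → EuclideanSpace ℝ (Fin 3)),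
    Literature.Analysis.FluidPDE.HasTypeITimeDecay C v →
    ContinuousOn (Function.uncurry v) (Set.Iio (0 : ℝ) ×ˢ Set.univ) →
    (∀ s t : ℝ, s < t → t < 0 → ∀ x, v t x =
      Literature.Analysis.UnboundedOperators.heatExtension (v s) (t - s) x -
        Literature.Analysis.FluidPDE.oseenDuhamel 1 s v v t x) →
    (∀ t < 0, Literature.Analysis.FluidPDE.VectorCalculus.IsDivFree (v t)) →
    (∀ s < 0, ∃ U : Set (EuclideanSpace ℝ (Fin 3)), IsOpen U ∧ U.Nonempty ∧
      ∀ y ∈ U, ⟪v s y, Literature.Analysis.FluidPDE.curl (v s) y⟫_ℝ = 0) →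
    ¬ Literature.Analysis.FluidPDE.IsBackwardSingularPoint v 0 :=
  fun C v hrate hcont hmild hdiv hwin =>
    hprofile C v hrate hcont hmild hdiv (helicityWindowToSlab C v hrate hcont hmild hdiv hwin)

end Summit.NavierStokesRegularity.NavierStokesRegularity.Theorems.LocalHelicityTubeDoorFrobeniusWindowRigidityWindow

end
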